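import Mathlib
import HarnessLib
import HarnessLib.Audit
import Summits.PneNP.Statement
import Literature.Computability.Complexity.Circuit
import Literature.Computability.Complexity.TimeBounds
import Literature.Computability.Complexity.BoolEncodings
import Literature.Computability.Complexity.Classes
import Literature.Computability.Complexity.Nondeterministic
import Literature.Computability.Complexity.PNPWave0
import Literature.Computability.MetaComplexity.TruthTables
import HarnessLib.Audit.Status.Attr

/-!
Route: MonochromaticLines

DORMANT since 2026-08-22T09:29:21Z (reconciler: no traction for 5.2 d (last activity item-evidence-added at 2026-08-17T03:06:44Z); parked, not closed — `ledger route dormant route-PneNP-MonochromaticLines --off` to reactivate) — unstaffed, not closed; items shared with open routes are served there. `ledger route dormant <id> --off` reactivates.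

# Route MonochromaticLines — P ≠ NP if the monochromatic lines of F_3^n that only the polynomial
method guarantees (2^(n/10) colours) cannot be found in polynomial time

It suffices to show X = "MONO-LINE(F_3^n) is not in FP" (card
PneNP/PneNP/cap-set-search-dimension-totality, sharpened to its
pure-dimension core). MONO-LINE: instance = n ≥ 200 and B₂-circuits C_1 … C_⌊n/10⌋ on 2n inputs,
read as a 2^⌊n/10⌋-colouring of F_3^n
(a point x < 3^n is fed as the 2n bits [digit_l(x)=1],[digit_l(x)=2]); solution = three pairwise
distinct points x, y, z with x+y+z = 0
(digitwise mod 3: an affine line) and C(x) = C(y) = C(z). TOTAL, because the largest colour class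
has ≥ 3^n/2^(n/10) > 3·#{v∈{0,1,2}^n :
Σv ≤ 2n/3} ≥ (slice rank of 1[x+y+z=0]) points, so by Croot–Lev–Pach/Ellenberg–Gijswijt in Tao's
slice-rank form it contains a line —
and at 2^(n/10) colours this is the ONLY known proof (colouring Ramsey/Hales–Jewett needs n ≥
tower(K) for K colours; Meshulam/Fourier
reaches K ≲ n, Kelley–Meka-type Fourier arguments 2^(n^c)). X says no polynomial-time machine maps
every valid instance to a solution;
P = NP would give one by prefix search (Assembly), so X → PneNP.
Lean: `MonoLineHard`

## Assembly
Pure logic plus two standard reductions, all typed: if ¬PneNP then every Cook-NP language is Cook-P;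
ClassBridge turns this into
Nondeterministic.NP ⊆ Classes.P; the Assembly item (provable now from the tree theorem
Literature.Computability.Complexity.exists_searchFn_of_NP_subset_P = Arora–Barak Thm 2.18, with R
from MonoLineCheckable, the length length bound
7n+8 ≤ 7·|encI I|+8 on the solution code and the existence of a solution from MonoLineTotal)
produces a polynomial-time solver
f = g ∘ encI, contradicting MonoLineHard. Deciding theorem (glue.lean, elaborates with the Sketch):
`closes hX hT hC hB hA := Classical.byContradiction fun hne => hX (hA hT hC (hB fun L hL =>
Classical.byContradiction fun hP => hne ⟨L, hL, hP⟩))`.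

Rationale: WHY THIS LINE. A deep non-constructive existence theorem read as a TFNP totality principle gives P ≠
NP from the hardness of its search problem; here the
existence lemma is a DIMENSION count (slice rank of the F_3-tensor 1[x+y+z=0], arXiv:1605.09223,
arXiv:1605.01506, SawinTao2016), not a
pigeonhole, and the tree already PROVES it (Literature.Combinatorics.Additive.hasSliceRankLE_piZMod,
IsTricoloredSumFree.card_le_of_addEquiv).
Imported areas: additive combinatorics (cap sets, supersaturation FoxLovasz2017, the
Fourier/polynomial-method divide Meshulam–Bateman–Katz
–Kelley–Meka vs CLP/EG) and the proof-complexity theory of black-box TFNP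
(GoosKamathRobereSokolov2019, arXiv:2205.02168, the Pecking Order of
arXiv:2401.12604). What is new relative to the card and to prior PneNP routes (DirichletPigeons =
pigeonhole/Dirichlet, RamseyAliens/PLC side):
the colouring IS a hash, so 3-PIGEON^(3^n)_(2^(n/10)) ≤ MONO-LINE by the identity map — hence
MONO-LINE is PWPP-hard, X ⇐ collision
resistance (KomargodskiNaorYogev2019-style), and by arXiv:2401.12604 Thm 4.9 MONO-LINE^dt ∉ PPP^dt
is already a corollary; the live
species claim is that the polynomial method sits above the WHOLE Pecking Order (∉ PAP^dt, crux #2)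
and above iterated pigeonhole (∉ PLC^dt).

RANKED CRUXES. #0 MonoLineHard (target) — X — no deterministic polynomial-time FinTM2 solves
MONO-LINE(F_3^n): for no f that maps every valid instance (n ≥ 200, fan-in ≤ 2) to the code ⟨bin x,
⟨bin y, bin z⟩⟩ of a monochromatic affine line is f computable in time poly(|⟨1^n, codes of
C_1..C_⌊n/10⌋⟩|) (instance code: unary n, then the Arora–Barak gate-list codes — truth table +
argument wires — of the circuits). (why it might fail: PWPP ⊄ FP ⇒ X ⇒ TFNP ⊄ FP ⇒ P ≠ NP, so X is
unprovable by relativising/algebrising means and is refuted by any polynomial white-box line finder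
(e.g. arithmetising the circuits over F_3 and running the slice-rank identity constructively).)
[arXiv:1605.09223, arXiv:1605.01506, KomargodskiNaorYogev2019, arXiv:2401.12604,
doi:10.1016/0304-3975(91)90200-L]
#2 MonoLineNotPAP (crux) — the polynomial method is not an averaging principle: MONO-LINE^dt lies
outside the whole Pecking Order — for every exponent a and all large n there is no depth-n^a
decision-tree reduction from MONO-LINE_n (oracle = the colouring c) to t-PIGEON^M_N for any 2 ≤ t ≤
n^a, M ≤ 2^(n^a), (t−1)N+1 ≤ M (pigeon u ↦ hole by a depth-d tree; every injective t-collision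
mapped back to a monochromatic line by a depth-d tree). t = 2 (∉ PPP^dt) is known (3-PIGEON ≤
MONO-LINE + arXiv:2401.12604 Thm 4.9); the content is t → poly(n), i.e. ∉ PAP^dt, the class that
contains BiRamsey (JLRX Thm 1.8) and UPLC. [difficulty: L] (why it might fail: a reduction may exist
(hash x ↦ (c(x), φ(x)) with fibres engineered so t-collisions contain lines — we only rule out
subspace/small fibres via caps of size ≥ √|fibre|); or JLRX collision-free pseudoexpectations need
gluability, and 'no monochromatic line' is dense (each point on 3^(n−1)·… lines).)
[arXiv:2401.12604, arXiv:2205.02168, GoosKamathRobereSokolov2019, KomargodskiNaorYogev2019,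
arXiv:2209.07625]
#3 MonoLineExpHard (crux) — fine-grained X: there is δ > 0 such that no f solving every valid
MONO-LINE instance is computed by a FinTM2 within c·2^(δn)·(L+1)^c steps (L = instance code length,
any c) — 'a dimension costs exponential time'; implies X (2^(δn) ≥ 1; pattern of DirichletPigeons
C2). Known upper bound 3^n·poly(L) (evaluate all colours, bucket, find a line in the largest class
by FFT over F_3^n); black-box randomized cost 2^Θ(n/10) on random colourings, ≤ 2^(1.39n/…) by
Fox–Lovász supersaturation sampling in the worst case. [deps: MonoLineHard] [difficulty:
open-problem] (why it might fail: a 2^(o(n))·poly(L) algorithm: e.g. birthday/k-tree search over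
structured families of lines, or density-increment (Kelley–Meka/Bloom–Sisask) made algorithmic on
succinct colour classes; refuting it only contracts the route to X.) [arXiv:1605.09223,
FoxLovasz2017, arXiv:2302.05537, arXiv:2302.07211, doi:10.1007/3-540-45708-9_19, arXiv:2401.12604]
#9 MonoLineTotal (support) — totality (provable now): for n ≥ 200 every colouring c : ℕ → (Fin
⌊n/10⌋ → Bool) admits pairwise distinct x, y, z < 3^n, digitwise x+y+z ≡ 0 (mod 3), with c x = c y =
c z. Proof: largest class A has |A| ≥ 3^n/2^⌊n/10⌋; view A ⊆ (Fin n → ZMod 3); if A had no line,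
s=t=u=incl is tricolored sum-free after translating u by −1 (IsTricoloredSumFree.card_le_of_addEquiv
with p=q=3, r=1, κ=Fin n, G'=PUnit) so |A| ≤ 3·#LowWeight 3 (Fin n); card_lowWeight_mul_pow_le with
v = 21/25 gives #LowWeight ≤ 2.75511^n, and 3^n/2^(n/10) > 3·2.75511^n for n ≥ 70 (exact margin 6.7
bits at n = 200). [difficulty: provable-now] [arXiv:1605.09223,
BlasiakChurchCohnGrochowNaslundSawinUmans2017,
Literature.Combinatorics.Additive.hasSliceRankLE_piZMod, arXiv:1907.01449]
#9 MonoLineCheckable (support) — solutions are polynomial-time checkable (provable now): some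
language R ∈ Classes.P satisfies, for every valid instance I and every string w, ⟨encI I, w⟩ ∈ R ↔ w
codes a monochromatic line of I. Take R = the strings accepted by the evaluator (parse ⟨1^n,
gate-list codes⟩ and ⟨bin x,⟨bin y,bin z⟩⟩, check x,y,z < 3^n pairwise distinct with digit sums ≡ 0,
evaluate each C_j on the trit-indicator bits of x, y, z and compare) — no code recognition needed
because the iff is only claimed on codes of valid instances; the code is Forrelation.lean's
encodeCircuit up to Sum.elim = match, evaluation as in CircuitEval.evalFn_mem_FP. [difficulty:
provable-now] [AroraBarakCC2009, Literature.Computability.Complexity.CircEval.evalFn_mem_FP,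
Literature.Computability.QuantumComplexity.encodeCircuit]
#9 ClassBridge (support) — model bridge (provable now, three lines from P_bool_eq_holds and
NP_bool_eq_holds of ClayProblem/ClayProblemProofs, kept out of the route's imports): if every
Cook-NP language over Bool is Cook-P then Nondeterministic.NP ⊆ Classes.P. [difficulty:
provable-now] [Literature.Computability.Complexity.P_bool_eq_holds,
Literature.Computability.Complexity.NP_bool_eq_holds, AroraBarakCC2009]
#9 MonoLineQueryLowerBound (support) — black-box calibration (provable now): for n ≥ 10, every
deterministic adaptive strategy making d < 2^⌊n/10⌋ colour queries (next query q(answers so far),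
output out(answers)) is fooled by some colouring: its output is not a monochromatic line. Adversary:
colour each newly queried point avoiding the ≤ (#coloured points) colours that would complete a
monochromatic line with two coloured points, then colour the (at most three) output points to break
the triple. [difficulty: provable-now] [arXiv:2401.12604, KomargodskiNaorYogev2019]
#9 CollisionReduces (support) — PWPP-type calibration (provable now, the solver itself is the
reduction): a polynomial-time MONO-LINE solver is a polynomial-time collision finder for the same
circuits read as a hash [3^n] → [2^⌊n/10⌋] (x ≠ y < 3^n with C(x) = C(y)); since COLLISION at any
polynomial compression is PWPP-complete (Jeřábek 2016, Merkle–Damgård) this yields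
'collision-resistant hashing ⇒ X' and 3-PIGEON^(3^n)_(2^(n/10)) ≤ MONO-LINE. [difficulty:
provable-now] [doi:10.1016/j.jcss.2015.08.001, KomargodskiNaorYogev2019, arXiv:2401.12604]

TWO-LAYER PLAN. Foreseen glued splits (none filed now): MonoLineNotPAP ⇐ (PseudoexpectationDesign: a
degree-n^a, (d,t,ε)-collision-free pseudoexpectation
for ¬MONO-LINE_n in the sense of arXiv:2401.12604 Def. 4.6, from local views of random colourings) →
(JLRX Thm 4.7 transfer, re-proved) →
MonoLineNotPAP; MonoLineExpHard ⇐ (black-box randomized 2^Ω(n) bound) → (white-box: no 2^(o(n))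
algorithm in a stated algorithm class) — only
after #2 moves. The DIAL as a later pair of items once a k-parametrised MONO-LINE_(n,k) is filed: k
≤ log₂ n − O(1) ⇒ TFZPP (Meshulam +
Fox–Lovász supersaturation, arXiv:2512.01138's class) versus k = n/10 ⇒ outside PAP/PLC;
conjecturally the Fourier/density-increment regime
k ≤ n^c is exactly where averaging-type membership returns.

KILL CRITERIA. A polynomial-time MONO-LINE algorithm refutes MonoLineHard: close
`refuted:MonoLineHard` (and record the algorithm — it would find
Ellenberg–Gijswijt lines constructively inside succinct sets, a result in itself). A 2^(o(n))·poly
algorithm refutes only MonoLineExpHard: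
drop #3, keep X. A black-box reduction MONO-LINE ≤ t-PIGEON (¬MonoLineNotPAP) kills the new-species
claim: the route degrades to 'X ⇐
multi-collision resistance', a variant of generic TFNP lines — close `superseded` in favour of
tfnp-totality-whitebox-transfer unless #3 has
moved. MonoLineTotal refuted-misstated (threshold) ⇒ repair n₀; PWPP ⊄ FP or CRHF-existence proved
elsewhere makes X a corollary (moot, happily).

NOT DECOMPOSED YET. The PLC side (crux #4 MonoLineNotPLC is filed informally after open:
LONG-CHOICE's definition is not typed); the PPA_q / PLS / PPADS
separations (corollaries of 3-PIGEON ≤ MONO-LINE plus Razborov1998-type degree bounds in the bit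
encoding, DantchevEtAl2020 — bookkeeping,
not cruxes); the randomized black-box bound (random colourings: a depth-t tree sees ≤ t² lines, each
monochromatic w.p. 4^(−k)); the
k-parametrised dial and its TFZPP end; average-case hardness for explicit colourings (quadratic
forms over F_3: an underdetermined-MQ
question); the true totality threshold k*/n ∈ [0.1228, 0.4343] (= the cap-set exponent problem,
deliberately not touched).

CHEAPEST FALSIFIER. (i) Literature: has a density-Roth/cap-set search problem already been placed in
PAP or PLC (JLRX §1.4 open problems, Li ITCS'24 'abundant
solutions', Bennett–Ghentiyala–Stephens-Davidowitz 2024, Fleming–Grosser–Pitassi–Robere STOC'24)? My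
arXiv searches ('arithmetic
progressions TFNP', 'cap set proof complexity', 'Szemeredi theorem total search problem', …) found
nothing. (ii) The one-line reduction test:
is x ↦ (c(x), x mod W) for a subspace W a reduction to t-PIGEON? No — a fibre (coset of dim w) needs
t > cap(F_3^w) ≥ 2^w-ish, exponential.
(iii) Numerics of totality at n = 200: checked exactly (gen. function), margin 6.7 bits; analytic
bound with v = 21/25 works for n ≥ 70.

NUMBERS. B_n := 3·#{v ∈ {0,1,2}^n : Σv ≤ 2n/3} ≤ 3·(2.75511)^n (log₂ 2.75511 = 1.4621;
KleinbergSawinSpeyer2018/BCCGNSU Prop. 4.12; exact counts: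
B_200 = 2^310.2…, checked); MONO-LINE_n total iff 3^n/2^k > B_n, i.e. k < 0.1228n − O(log n): our k
= ⌊n/10⌋, n ≥ 200 (margin 6.7 bits at
200, 12.0 at 400). Non-total once 2^k ≥ n·3^n/|A| for a cap set A: |A| ≥ 2.2202^n (Romera-Paredes et
al., Nature 625 (2024); Tyrrell
arXiv:2209.10045: 2.2180^n; Edel 2004: 2.2174^n) ⇒ k ≥ 0.4343n + log₂ n; so k*/n ∈ [0.1228, 0.4343].
Fox–Lovász: c₃ = 1 − log₃ 2.7551 =
0.0775, C₃ = 1 + 1/c₃ ≈ 13.9. Black-box: deterministic ≥ 2^⌊n/10⌋ queries (item); JLRX Thm 4.9 (t =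
2): no depth-d reduction of
3-PIGEON^M_N to PIGEON when d² ≤ N/2, so MONO-LINE_n ∉ PPP^dt with d < 2^(n/20)/√2. White-box upper
bound 3^n·poly. Items at open: 9 typed
(target, assembly, 2 cruxes, 5 support) + 1 informal crux.

DEFINITION REQUESTS. None blocking: circuits (Literature.Computability.Complexity.Circuit),
encodings (boolPair, encodeNat, unaryEncodeNat, truthTable), classes
(Classes.P, Nondeterministic.NP, FP via PolyTimeComputable) and the slice-rank bound exist. Wanted
later (not filed now): a reusable
`DecisionTreeReduction` / t-PIGEON^dt vocabulary under Literature/Computability/Complexity (today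
inlined via Nat.rec query runs), and
LONG-CHOICE (PLC) for crux #4.

Novelty: Searches (2026-08-15): `lit search --source arxiv`: 'separations proof complexity TFNP' (7:
arXiv:2205.02168, 2401.12604 READ pp.3–10,13,15,18,
2512.01138 READ pp.2–4, 2602.16810 …), 'van der Waerden proof complexity' (4, none relevant),
'arithmetic progressions TFNP' (0), 'Roth theorem
bounded arithmetic' (6, none relevant), 'cap set proof complexity' (6, none relevant), 'density
Hales-Jewett proof complexity' (0), 'Szemeredi
theorem total search problem' (0), 'three-term progression search problem succinct' (0),
'PPP-completeness extremal combinatorics' (2209.04827,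
2209.07625 READ grep Ramsey/Thm 4), 'total search problems with abundant solutions' (0), 'black-box
PPP is not Turing-closed' (0);
`lit galaxy search --star all "monochromatic arithmetic progression total search problem"` (0/0/0);
local searchd rc 75, OpenAlex/S2 HTTP 429
this session (logged); card's own audit searches ('cap set TFNP', 'succinct cap set', …) inherited.
Nearest prior art found: arXiv:2401.12604 (Jain–Li–Robere–Xun, FOCS 2024: Pecking Order t-PPP/PAP,
RAMSEY ∉ PPP^dt, BiRamsey ∈ PAP, PLS/PPA ⊄
PAP^dt, open: 'fine-grained study of extremal combinatorics problems w.r.t. PLC and the Pecking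
Order'); arXiv:2209.07625 (PPY23: PLC, Ramsey ∈
PLC Thm 4); KomargodskiNaorYogev2019 (white-box Ramsey hardness from CRHF); arXiv:1605.09223 /
SawinTao2016 (the totality theorem);
arXiv:2512.01138 (TFZPP, the dense end of the dial).
Delta: the first TFNP problem whose only totality proof is the polynomial method  [refs: 2205.02168, 2401.12604, 2209.07625, 1605.09223, 2512.01138, KomargodskiNaorYogev2019, SawinTao2016]

Barriers (technique_class: tfnp-totality, polynomial-method, slice-rank, pecking-order): - technique_class: tfnp-totality, polynomial-method, slice-rank, pecking-order
- Literature.Barriers.PneNP.Relativization: X ⇒ PneNP relativises and fails relative to any P = NP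
oracle; not evaded — the bet (as for every TFNP line) is that problem-specific white-box structure
enters through #2/#3; the unconditional content claimed is black-box (#2, supports), where
relativisation is the model, not a barrier.
- Literature.Barriers.PneNP.Algebrization: same status as relativisation for X and #3
(Aaronson–Wigderson); the dt-separation #2 is immune (oracle-world statement).
- Literature.Barriers.PneNP.NaturalProofs: not applicable — no largeness/constructivity property of
truth tables is used; X is a uniform statement about one total search problem.
- Literature.Barriers.PneNP.NPHardnessToOneWayFunctions: respected, not fought: MONO-LINE ∈ TFNP
cannot be NP-hard unless NP = coNP (Megiddo–Papadimitriou), so X is calibrated from BELOW by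
cryptography (CollisionReduces: CRHF ⇒ X), never argued via NP-hardness.
- Literature.Barriers.PneNP.LatticeGapCoNP: the same collapse principle (hardness inside a
certificate-rich class) is why no NP-hardness claim appears; acknowledged.
- Literature.Barriers.PneNP.CompositeModulusDegree: not applicable — 'polynomial method' here is
Croot–Lev–Pach/Ellenberg–Gijswijt slice rank used as the EXISTENCE lemma of a search problem (an
F_3-tensor identity), not Razborov–Smolensky low-degree approximation of AC⁰[m] circuits; no modular
gate, circuit class

Novelty grade: new-combination — route-review rreview-0815T18-7 (refuter): KEEP; new-combination confirmed on an outage-limited search (arXiv 'cap set search problem TFNP' -> only 2512.01138; GKSZ arXiv:1912.04467: Chevalley-Warning, a polynomial-method totality, sits in PPA_q — nearest counter-analogy, harmless since 3-PIGEON <= M (refuter refuter-rreview-0815T18-7-0, 2026-08-15T19:09:23Z; prior: arXiv:2401.12604, arXiv:2209.07625, arXiv:1912.04467, arXiv:1605.09223, KomargodskiNaorYogev2019, arXiv:2512.01138)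

History (route lifecycle, newest last):
- 2026-08-16T04:14:27Z · AUTO-CRUX (backfill): MonoLineHard — hypotheses of the deciding theorem that nothing in the route derives are cruxes (operator:999:1085951)
- 2026-08-22T09:29:21Z · DORMANT — reconciler: no traction for 5.2 d (last activity item-evidence-added at 2026-08-17T03:06:44Z); parked, not closed — `ledger route dormant route-PneNP-Monochroma (operator:999:383219)

sub-problem: PneNP · status: dormant · opened planner-plancard-PneNP-PneNP-cap-set-search-d-97e4efc7-0 2026-08-15T18:42:40Z · rev 1 · ledger route-PneNP-MonochromaticLines
GENERATED by the gate from the ledger (D-0016/17). Provers cite these decls: `theorem foo : Summit.PneNP.PneNP.Theses.MonochromaticLines.<Decl> := …` in Summits/PneNP/PneNP/Theorems/<Name>.lean.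
-/

namespace Summit.PneNP.PneNP.Theses.MonochromaticLines

open scoped BigOperators Topology Manifold Classical MeasureTheory ProbabilityTheory Matrix InnerProductSpace ComplexConjugate ContinuousMap
open Filter Set Function TopologicalSpace MeasureTheory

attribute [summit_statement] _root_.PneNP

open Literature.PNP

/-- item stmt-PneNP-11755 · crux (kind.auto-crux: conjecture-grade) · rank 0 · open · by planner
why it might fail: X sits above P≠NP (CRHF ⇒ PWPP⊄FP ⇒ X ⇒ TFNP⊄FP ⇒ P≠NP): no relativising/algebrising proof exists; and any white-box poly-time line finder for succinct colour classes of density 2^(-n/10) (e.g. a constructive slice-rank/Croot–Lev–Pach argument on the circuits arithmetised over F_3) refutes it.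
sources: arXiv:1605.09223, arXiv:1605.01506, KomargodskiNaorYogev2019, arXiv:2401.12604, doi:10.1016/0304-3975(91)90200-L, Literature.Barriers.PneNP.Relativization
[target] X — no deterministic polynomial-time FinTM2 solves MONO-LINE(F_3^n): for no f that maps
every valid instance (n ≥ 200, fan-in ≤ 2) to the code ⟨bin x, ⟨bin y, bin z⟩⟩ of a monochromatic
affine line is f computable in time poly(|⟨1^n, codes of C_1..C_⌊n/10⌋⟩|) (instance code: unary n,
then the Arora–Barak gate-list codes — truth table + argument wires — of the circuits). -/
@[route_item "route-PneNP-MonochromaticLines", crux]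
def MonoLineHard : Prop :=
  let IsLine : ℕ → ℕ → ℕ → ℕ → Prop := fun n x y z => x < 3 ^ n ∧ y < 3 ^ n ∧ z < 3 ^ n ∧ x ≠ y ∧ y ≠ z ∧ x ≠ z ∧ ∀ l : ℕ, l < n → (x / 3 ^ l % 3 + y / 3 ^ l % 3 + z / 3 ^ l % 3) % 3 = 0; let col : (I : (Σ n : ℕ, (Fin (n / 10) → Literature.Computability.Complexity.Circuit (Fin (2 * n))))) → ℕ → (Fin (I.1 / 10) → Bool) := fun I x j => (I.2 j).eval (fun i : Fin (2 * I.1) => decide (x / 3 ^ ((i : ℕ) / 2) % 3 = (i : ℕ) % 2 + 1)); let Valid : (Σ n : ℕ, (Fin (n / 10) → Literature.Computability.Complexity.Circuit (Fin (2 * n)))) → Prop := fun I => 200 ≤ I.1 ∧ ∀ j : Fin (I.1 / 10), ∀ g ∈ (I.2 j).gates, g.arity ≤ 2; let dec : List Bool → ℕ × ℕ × ℕ := fun w => (Computability.decodeNat (Literature.Computability.Complexity.boolUnpair w).1, Computability.decodeNat (Literature.Computability.Complexity.boolUnpair (Literature.Computability.Complexity.boolUnpair w).2).1, Computability.decodeNat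 (Literature.Computability.Complexity.boolUnpair (Literature.Computability.Complexity.boolUnpair w).2).2); let SolStr : (I : (Σ n : ℕ, (Fin (n / 10) → Literature.Computability.Complexity.Circuit (Fin (2 * n))))) → List Bool → Prop := fun I w => IsLine I.1 (dec w).1 (dec w).2.1 (dec w).2.2 ∧ col I (dec w).1 = col I (dec w).2.1 ∧ col I (dec w).2.1 = col I (dec w).2.2; let wire : (m : ℕ) → Fin m ⊕ ℕ → List Bool := fun m w => Sum.elim (fun i : Fin m => false :: Computability.encodeNat (i : ℕ)) (fun j : ℕ => true :: Computability.encodeNat j) w; let code : (m : ℕ) → Literature.Computability.Complexity.Circuit (Fin m) → List Bool := fun m C => Literature.Computability.Complexity.boolPair ((C.gates.map fun g => Literature.Computability.Complexity.boolPair (Literature.Computability.MetaComplexity.truthTable g.op) ((List.ofFn fun a : Fin g.arity => wire m (g.args a)).foldr Literature.Computability.Complexity.boolPair [])).foldr Literature.Computability.Complexity.boolPair []) (wire m C.output); let encI : (Σ n : ℕ, (Fin (n / 10) → Literature.Computability.Complexity.Circuit (Fin (2 * n)))) → List Bool := fun I => Literature.Computability.Complexity.boolPair (Computability.unaryEncodeNat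 I.1) ((List.ofFn fun j : Fin (I.1 / 10) => code (2 * I.1) (I.2 j)).foldr Literature.Computability.Complexity.boolPair []); ¬ ∃ f : (Σ n : ℕ, (Fin (n / 10) → Literature.Computability.Complexity.Circuit (Fin (2 * n)))) → List Bool, (∀ I, Valid I → SolStr I (f I)) ∧ Literature.Computability.Complexity.PolyTimeComputable encI (id : List Bool → List Bool) f

/-- item stmt-PneNP-11756 · crux · rank 2 · open · by planner
why it might fail: False if MONO-LINE ≤ poly(n)-PIGEON via a hashing whose t-collisions force a line — how JLRX put (n−√n)/2-BiRamsey in PAP; only subspace fibres are excluded (every S ⊆ F_3^n has a cap ≥ |S|^0.7). The one tool against PAP^dt, collision-free pseudoexpectations, needs gluability — unclear here.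
sources: arXiv:2401.12604, arXiv:2205.02168, arXiv:2209.07625, arXiv:2512.01138, GoosKamathRobereSokolov2019, KomargodskiNaorYogev2019
[crux] the polynomial method is not an averaging principle: MONO-LINE^dt lies outside the whole
Pecking Order — for every exponent a and all large n there is no depth-n^a decision-tree reduction
from MONO-LINE_n (oracle = the colouring c) to t-PIGEON^M_N for any 2 ≤ t ≤ n^a, M ≤ 2^(n^a),
(t−1)N+1 ≤ M (pigeon u ↦ hole by a depth-d tree; every injective t-collision mapped back to a
monochromatic line by a depth-d tree). t = 2 (∉ PPP^dt) is known (3-PIGEON ≤ MONO-LINE +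
arXiv:2401.12604 Thm 4.9); the content is t → poly(n), i.e. ∉ PAP^dt, the class that contains
BiRamsey (JLRX Thm 1.8) and UPLC. [difficulty: L] -/
@[route_item "route-PneNP-MonochromaticLines"]
def MonoLineNotPAP : Prop :=
  let IsLine : ℕ → ℕ → ℕ → ℕ → Prop := fun n x y z => x < 3 ^ n ∧ y < 3 ^ n ∧ z < 3 ^ n ∧ x ≠ y ∧ y ≠ z ∧ x ≠ z ∧ ∀ l : ℕ, l < n → (x / 3 ^ l % 3 + y / 3 ^ l % 3 + z / 3 ^ l % 3) % 3 = 0; let run : (n : ℕ) → (List (Fin (n / 10) → Bool) → ℕ) → (ℕ → (Fin (n / 10) → Bool)) → ℕ → List (Fin (n / 10) → Bool) := fun n q c d => @Nat.rec (fun _ => List (Fin (n / 10) → Bool)) [] (fun _ acc => acc ++ [c (q acc)]) d; let Mono : (n : ℕ) → (ℕ → (Fin (n / 10) → Bool)) → ℕ × ℕ × ℕ → Prop := fun n c s => IsLine n s.1 s.2.1 s.2.2 ∧ c s.1 = c s.2.1 ∧ c s.2.1 = c s.2.2; ∀ a : ℕ, ∃ n₀ : ℕ, ∀ n : ℕ,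 n₀ ≤ n → ∀ t M N d : ℕ, 2 ≤ t → t ≤ n ^ a → d ≤ n ^ a → M ≤ 2 ^ (n ^ a) → (t - 1) * N + 1 ≤ M → ¬ ∃ (hq : Fin M → List (Fin (n / 10) → Bool) → ℕ) (hv : Fin M → List (Fin (n / 10) → Bool) → Fin N) (sq : (Fin t → Fin M) → List (Fin (n / 10) → Bool) → ℕ) (sv : (Fin t → Fin M) → List (Fin (n / 10) → Bool) → ℕ × ℕ × ℕ), ∀ c : ℕ → (Fin (n / 10) → Bool), ∀ s : Fin t → Fin M, Function.Injective s → (∀ i j : Fin t, hv (s i) (run n (hq (s i)) c d) = hv (s j) (run n (hq (s j)) c d)) → Mono n c (sv s (run n (sq s) c d))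

/-- item stmt-PneNP-11757 · crux · rank 3 · open · by planner
why it might fail: A 2^(o(n))·poly(L) white-box algorithm refutes it, e.g. Wagner k-tree/birthday search over structured line families or an algorithmic density increment (Meshulam/Kelley–Meka) on succinct colour classes; known bounds (2^⌊n/10⌋ queries, 3^n·poly brute force) are black-box only. A proof gives X ⇒ P≠NP.
sources: arXiv:1605.09223, FoxLovasz2017, arXiv:2302.05537, arXiv:2302.07211, doi:10.1007/3-540-45708-9_19, arXiv:2401.12604
[crux] fine-grained X: there is δ > 0 such that no f solving every valid MONO-LINE instance is
computed by a FinTM2 within c·2^(δn)·(L+1)^c steps (L = instance code length, any c) — 'a dimension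
costs exponential time'; implies X (2^(δn) ≥ 1; pattern of DirichletPigeons C2). Known upper bound
3^n·poly(L) (evaluate all colours, bucket, find a line in the largest class by FFT over F_3^n);
black-box randomized cost 2^Θ(n/10) on random colourings, ≤ 2^(1.39n/…) by Fox–Lovász
supersaturation sampling in the worst case. [deps: MonoLineHard] [difficulty: open-problem] -/
@[route_item "route-PneNP-MonochromaticLines"]
def MonoLineExpHard : Prop :=
  let IsLine : ℕ → ℕ → ℕ → ℕ → Prop := fun n x y z => x < 3 ^ n ∧ y < 3 ^ n ∧ z < 3 ^ n ∧ x ≠ y ∧ y ≠ z ∧ x ≠ z ∧ ∀ l : ℕ, l < n → (x / 3 ^ l % 3 + y / 3 ^ l % 3 + z / 3 ^ l % 3) % 3 = 0; let col : (I : (Σ n : ℕ, (Fin (n / 10) → Literature.Computability.Complexity.Circuit (Fin (2 * n))))) → ℕ → (Fin (I.1 / 10) → Bool) := fun I x j => (I.2 j).eval (fun i : Fin (2 * I.1) => decide (x / 3 ^ ((i : ℕ) / 2) % 3 = (i : ℕ) % 2 + 1)); let Valid : (Σ n : ℕ, (Fin (n / 10) → Literature.Computability.Complexity.Circuit (Fin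 (2 * n)))) → Prop := fun I => 200 ≤ I.1 ∧ ∀ j : Fin (I.1 / 10), ∀ g ∈ (I.2 j).gates, g.arity ≤ 2; let dec : List Bool → ℕ × ℕ × ℕ := fun w => (Computability.decodeNat (Literature.Computability.Complexity.boolUnpair w).1, Computability.decodeNat (Literature.Computability.Complexity.boolUnpair (Literature.Computability.Complexity.boolUnpair w).2).1, Computability.decodeNat (Literature.Computability.Complexity.boolUnpair (Literature.Computability.Complexity.boolUnpair w).2).2); let SolStr : (I : (Σ n : ℕ, (Fin (n / 10) → Literature.Computability.Complexity.Circuit (Fin (2 * n))))) → List Bool → Prop := fun I w => IsLine I.1 (dec w).1 (dec w).2.1 (dec w).2.2 ∧ col I (dec w).1 = col I (dec w).2.1 ∧ col I (dec w).2.1 = col I (dec w).2.2; let wire : (m : ℕ) → Fin m ⊕ ℕ → List Bool := fun m w => Sum.elim (fun i : Fin m => false :: Computability.encodeNat (i : ℕ)) (fun j : ℕ => true :: Computability.encodeNat j) w; let code : (m : ℕ) → Literature.Computability.Complexity.Circuit (Fin m) → List Bool := fun m C => Literature.Computability.Complexity.boolPair ((C.gates.map fun g => Literature.Computability.Complexity.boolPair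 (Literature.Computability.MetaComplexity.truthTable g.op) ((List.ofFn fun a : Fin g.arity => wire m (g.args a)).foldr Literature.Computability.Complexity.boolPair [])).foldr Literature.Computability.Complexity.boolPair []) (wire m C.output); let encI : (Σ n : ℕ, (Fin (n / 10) → Literature.Computability.Complexity.Circuit (Fin (2 * n)))) → List Bool := fun I => Literature.Computability.Complexity.boolPair (Computability.unaryEncodeNat I.1) ((List.ofFn fun j : Fin (I.1 / 10) => code (2 * I.1) (I.2 j)).foldr Literature.Computability.Complexity.boolPair []); let expPoly : ℝ → (ℕ → ℕ → ℕ) → Prop := fun δ T => ∃ c : ℕ, ∀ n L : ℕ, (T n L : ℝ) ≤ c * (2 : ℝ) ^ (δ * n) * ((L : ℝ) + 1) ^ c; ∃ δ : ℝ, 0 < δ ∧ ∀ f : (Σ n : ℕ, (Fin (n / 10) → Literature.Computability.Complexity.Circuit (Fin (2 * n)))) → List Bool, (∀ I, Valid I → SolStr I (f I)) → ¬ ∃ T : ℕ → ℕ → ℕ, expPoly δ T ∧ ∃ M, Literature.Computability.Complexity.ComputesInTime encI (id : List Bool → List Bool) f (fun I => T I.1 (encI I).length) M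

/-- item stmt-PneNP-12145 · crux · rank 4 · open · by planner
why it might fail: May be false: a density increment (Meshulam/Kelley–Meka) IS an iterated-majority argument, PLC ⊇ PPP, PLS is large, and NO black-box lower bound against adaptive Long Choice is known for any problem (PPY §8; JLRX reach only UPLC ⊆ PAP); also untyped: LONG-CHOICE must be inlined before any attack.
sources: arXiv:2209.07625, arXiv:2401.12604, arXiv:2312.04051, arXiv:1605.09223, doi:10.1016/0097-3165(95)90024-1
[crux] MonoLineNotPLC — iterated pigeonhole cannot prove Ellenberg–Gijswijt: MONO-LINE^dt (oracle =
a 2^⌊n/10⌋-colouring c of F_3^n, n ≥ 200; solution = monochromatic affine line x+y+z=0, pairwise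
distinct) has no poly(n)-depth black-box (decision-tree) reduction to LONG-CHOICE / Binary Long
Choice of Pasarkar–Papadimitriou–Yannakakis (arXiv:2209.07625 Def. of PLC, Thm 1; RAMSEY ∈ PLC by
their Thm 4), i.e. MONO-LINE^dt ∉ PLC^dt — companion of the typed crux MonoLineNotPAP (Pecking Order
side, arXiv:2401.12604). To be typed once LONG-CHOICE's nested-choice predicate format is rendered
(same Nat.rec query-run vocabulary as MonoLineNotPAP). Why it might fail: no lower-bound technique
against PLC^dt is known (JLRX §1.4 lists PLC vs PAP as open); a density-increment proof
(Meshulam/Kelley–Meka) IS an iterated-pigeonhole-flavoured argument and might place the k ≤ n^c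
regime in PLC, and an unexpected combinatorial proof of cap-set-type bounds at 2^(n/10) colours
would place all of it there. Sources: arXiv:2209.07625, arXiv:2401.12604, arXiv:1605.09223,
doi:10.1016/0097-3165(95)90024-1. [deps: MonoLineNotPAP] [difficulty: XL] -/
@[route_item "route-PneNP-MonochromaticLines"]
def MonoLineNotPLC : Prop :=
  let IsLine : ℕ → ℕ → ℕ → ℕ → Prop := fun n x y z => x < 3 ^ n ∧ y < 3 ^ n ∧ z < 3 ^ n ∧ x ≠ y ∧ y ≠ z ∧ x ≠ z ∧ ∀ l : ℕ, l < n → (x / 3 ^ l % 3 + y / 3 ^ l % 3 + z / 3 ^ l % 3) % 3 = 0; let run : (n : ℕ) → (List (Fin (n / 10) → Bool) → ℕ) → (ℕ → (Fin (n / 10) → Bool)) → ℕ → List (Fin (n / 10) → Bool) := fun n q c d => @Nat.rec (fun _ => List (Fin (n / 10) → Bool)) [] (fun _ acc => acc ++ [c (q acc)]) d; let Mono : (n : ℕ) → (ℕ → (Fin (n / 10) → Bool)) → ℕ × ℕ × ℕ → Prop := fun n c s => IsLine n s.1 s.2.1 s.2.2 ∧ c s.1 = c s.2.1 ∧ c s.2.1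 = c s.2.2; ∀ a : ℕ, ∃ n₀ : ℕ, ∀ n : ℕ, n₀ ≤ n → ∀ m d : ℕ, m ≤ n ^ a → d ≤ n ^ a → ¬ ∃ (pq : List (Fin (2 ^ m)) → Fin (2 ^ m) → List (Fin (n / 10) → Bool) → ℕ) (pv : List (Fin (2 ^ m)) → Fin (2 ^ m) → List (Fin (n / 10) → Bool) → Bool) (sq : (Fin (m + 1) → Fin (2 ^ m)) → List (Fin (n / 10) → Bool) → ℕ) (sv : (Fin (m + 1) → Fin (2 ^ m)) → List (Fin (n / 10) → Bool) → ℕ × ℕ × ℕ), ∀ c : ℕ → (Fin (n / 10) → Bool), ∀ s : Fin (m + 1) → Fin (2 ^ m), Function.Injective s → (∀ i j j' : Fin (m + 1), i < j → i < j' → pv ((List.ofFn s).take ((i : ℕ) + 1)) (s j) (run n (pq ((List.ofFn s).take ((i : ℕ) + 1)) (s j)) c d) = pv ((List.ofFn s).take ((i : ℕ) + 1)) (s j') (run n (pq ((List.ofFn s).take ((i : ℕ) + 1)) (s j')) c d)) → Mono n c (sv s (run n (sq s) c d))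

/-- item stmt-PneNP-11758 · support · rank 9 · closed · proved by Summit.PneNP.PneNP.Theorems.monochromaticLines_monoLineTotal_proof @ 32941a475f59 (prover) · by planner
sources: arXiv:1605.09223, BlasiakChurchCohnGrochowNaslundSawinUmans2017, Literature.Combinatorics.Additive.hasSliceRankLE_piZMod, arXiv:1907.01449
[support] totality (provable now): for n ≥ 200 every colouring c : ℕ → (Fin ⌊n/10⌋ → Bool) admits
pairwise distinct x, y, z < 3^n, digitwise x+y+z ≡ 0 (mod 3), with c x = c y = c z. Proof: largest
class A has |A| ≥ 3^n/2^⌊n/10⌋; view A ⊆ (Fin n → ZMod 3); if A had no line, s=t=u=incl is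
tricolored sum-free after translating u by −1 (IsTricoloredSumFree.card_le_of_addEquiv with p=q=3,
r=1, κ=Fin n, G'=PUnit) so |A| ≤ 3·#LowWeight 3 (Fin n); card_lowWeight_mul_pow_le with v = 21/25
gives #LowWeight ≤ 2.75511^n, and 3^n/2^(n/10) > 3·2.75511^n for n ≥ 70 (exact margin 6.7 bits at n
= 200). [difficulty: provable-now] -/
@[route_item "route-PneNP-MonochromaticLines", crux]
def MonoLineTotal : Prop :=
  let IsLine : ℕ → ℕ → ℕ → ℕ → Prop := fun n x y z => x < 3 ^ n ∧ y < 3 ^ n ∧ z < 3 ^ n ∧ x ≠ y ∧ y ≠ z ∧ x ≠ z ∧ ∀ l : ℕ, l < n → (x / 3 ^ l % 3 + y / 3 ^ l % 3 + z / 3 ^ l % 3) % 3 = 0; ∀ n : ℕ, 200 ≤ n → ∀ c : ℕ → (Fin (n / 10) → Bool), ∃ x y z : ℕ, IsLine n x y z ∧ c x = c y ∧ c y = c z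

/-- item stmt-PneNP-11759 · support · rank 9 · closed · proved by Summit.PneNP.PneNP.Theorems.monochromaticLines_monoLineCheckable_proof @ 3a56f07a3cbb (prover) · by planner
sources: AroraBarakCC2009, Literature.Computability.Complexity.CircEval.evalFn_mem_FP, Literature.Computability.QuantumComplexity.encodeCircuit
[support] solutions are polynomial-time checkable (provable now): some language R ∈ Classes.P
satisfies, for every valid instance I and every string w, ⟨encI I, w⟩ ∈ R ↔ w codes a monochromatic
line of I. Take R = the strings accepted by the evaluator (parse ⟨1^n, gate-list codes⟩ and ⟨bin
x,⟨bin y,bin z⟩⟩, check x,y,z < 3^n pairwise distinct with digit sums ≡ 0, evaluate each C_j on the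
trit-indicator bits of x, y, z and compare) — no code recognition needed because the iff is only
claimed on codes of valid instances; the code is Forrelation.lean's encodeCircuit up to Sum.elim =
match, evaluation as in CircuitEval.evalFn_mem_FP. [difficulty: provable-now] -/
@[route_item "route-PneNP-MonochromaticLines", crux]
def MonoLineCheckable : Prop :=
  let IsLine : ℕ → ℕ → ℕ → ℕ → Prop := fun n x y z => x < 3 ^ n ∧ y < 3 ^ n ∧ z < 3 ^ n ∧ x ≠ y ∧ y ≠ z ∧ x ≠ z ∧ ∀ l : ℕ, l < n → (x / 3 ^ l % 3 + y / 3 ^ l % 3 + z / 3 ^ l % 3) % 3 = 0; let col : (I : (Σ n : ℕ, (Fin (n / 10) → Literature.Computability.Complexity.Circuit (Fin (2 * n))))) → ℕ → (Fin (I.1 / 10) → Bool) := fun I x j => (I.2 j).eval (fun i : Fin (2 * I.1) => decide (x / 3 ^ ((i : ℕ) / 2) % 3 = (i : ℕ) % 2 + 1)); let Valid : (Σ n : ℕ, (Fin (n / 10) → Literature.Computability.Complexity.Circuit (Fin (2 * n)))) → Prop := fun I => 200 ≤ I.1 ∧ ∀ j : Fin (I.1 / 10), ∀ g ∈ (I.2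 j).gates, g.arity ≤ 2; let dec : List Bool → ℕ × ℕ × ℕ := fun w => (Computability.decodeNat (Literature.Computability.Complexity.boolUnpair w).1, Computability.decodeNat (Literature.Computability.Complexity.boolUnpair (Literature.Computability.Complexity.boolUnpair w).2).1, Computability.decodeNat (Literature.Computability.Complexity.boolUnpair (Literature.Computability.Complexity.boolUnpair w).2).2); let SolStr : (I : (Σ n : ℕ, (Fin (n / 10) → Literature.Computability.Complexity.Circuit (Fin (2 * n))))) → List Bool → Prop := fun I w => IsLine I.1 (dec w).1 (dec w).2.1 (dec w).2.2 ∧ col I (dec w).1 = col I (dec w).2.1 ∧ col I (dec w).2.1 = col I (dec w).2.2; let wire : (m : ℕ) → Fin m ⊕ ℕ → List Bool := fun m w => Sum.elim (fun i : Fin m => false :: Computability.encodeNat (i : ℕ)) (fun j : ℕ => true :: Computability.encodeNat j) w; let code : (m : ℕ) → Literature.Computability.Complexity.Circuit (Fin m) → List Bool := fun m C => Literature.Computability.Complexity.boolPair ((C.gates.map fun g => Literature.Computability.Complexity.boolPair (Literature.Computability.MetaComplexity.truthTable g.op) ((List.ofFn fun a : Fin g.arity => wire m (g.args a)).foldr Literature.Computability.Complexity.boolPair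 [])).foldr Literature.Computability.Complexity.boolPair []) (wire m C.output); let encI : (Σ n : ℕ, (Fin (n / 10) → Literature.Computability.Complexity.Circuit (Fin (2 * n)))) → List Bool := fun I => Literature.Computability.Complexity.boolPair (Computability.unaryEncodeNat I.1) ((List.ofFn fun j : Fin (I.1 / 10) => code (2 * I.1) (I.2 j)).foldr Literature.Computability.Complexity.boolPair []); ∃ R ∈ Literature.Computability.Complexity.Classes.P, ∀ I : (Σ n : ℕ, (Fin (n / 10) → Literature.Computability.Complexity.Circuit (Fin (2 * n)))), Valid I → ∀ w : List Bool, Literature.Computability.Complexity.boolPair (encI I) w ∈ R ↔ SolStr I w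

/-- item stmt-PneNP-11760 · support · rank 9 · closed · proved by Summit.PneNP.PneNP.Theorems.monochromaticLines_classBridge_proof @ 55cb6480042c (prover) · by planner
sources: Literature.Computability.Complexity.P_bool_eq_holds, Literature.Computability.Complexity.NP_bool_eq_holds, AroraBarakCC2009
[support] model bridge (provable now, three lines from P_bool_eq_holds and NP_bool_eq_holds of
ClayProblem/ClayProblemProofs, kept out of the route's imports): if every Cook-NP language over Bool
is Cook-P then Nondeterministic.NP ⊆ Classes.P. [difficulty: provable-now] -/
@[route_item "route-PneNP-MonochromaticLines", crux]
def ClassBridge : Prop :=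
  Literature.Computability.Complexity.PNPWave0.NP Bool ⊆ Literature.Computability.Complexity.PNPWave0.P Bool → Literature.Computability.Complexity.Nondeterministic.NP ⊆ Literature.Computability.Complexity.Classes.P

/-- item stmt-PneNP-11761 · support · rank 9 · closed · proved by Summit.PneNP.PneNP.Theorems.monochromaticLines_monoLineQueryLowerBound_proof @ ed9034cd3f25 (prover) · by planner
sources: arXiv:2401.12604, KomargodskiNaorYogev2019
[support] black-box calibration (provable now): for n ≥ 10, every deterministic adaptive strategy
making d < 2^⌊n/10⌋ colour queries (next query q(answers so far), output out(answers)) is fooled by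
some colouring: its output is not a monochromatic line. Adversary: colour each newly queried point
avoiding the ≤ (#coloured points) colours that would complete a monochromatic line with two coloured
points, then colour the (at most three) output points to break the triple. [difficulty:
provable-now] -/
@[route_item "route-PneNP-MonochromaticLines"]
def MonoLineQueryLowerBound : Prop :=
  let IsLine : ℕ → ℕ → ℕ → ℕ → Prop := fun n x y z => x < 3 ^ n ∧ y < 3 ^ n ∧ z < 3 ^ n ∧ x ≠ y ∧ y ≠ z ∧ x ≠ z ∧ ∀ l : ℕ, l < n → (x / 3 ^ l % 3 + y / 3 ^ l % 3 + z / 3 ^ l % 3) % 3 = 0; let run : (n : ℕ) → (List (Fin (n / 10) → Bool) → ℕ) → (ℕ → (Fin (n / 10) → Bool)) → ℕ → List (Fin (n / 10) → Bool) := fun n q c d => @Nat.rec (fun _ => List (Fin (n / 10) → Bool)) [] (fun _ acc => acc ++ [c (q acc)]) d; let Mono : (n : ℕ) → (ℕ → (Fin (n / 10) → Bool)) → ℕ × ℕ × ℕ → Prop := fun n c s => IsLine n s.1 s.2.1 s.2.2 ∧ c s.1 = c s.2.1 ∧ c s.2.1 = c s.2.2; ∀ n : ℕ, 10 ≤ n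 → ∀ d : ℕ, d < 2 ^ (n / 10) → ∀ (q : List (Fin (n / 10) → Bool) → ℕ) (out : List (Fin (n / 10) → Bool) → ℕ × ℕ × ℕ), ∃ c : ℕ → (Fin (n / 10) → Bool), ¬ Mono n c (out (run n q c d))

/-- item stmt-PneNP-11762 · support · rank 9 · closed · proved by Summit.PneNP.PneNP.Theorems.monochromaticLines_collisionReduces_proof @ 9bd3963d100e (prover) · by planner
sources: doi:10.1016/j.jcss.2015.08.001, KomargodskiNaorYogev2019, arXiv:2401.12604
[support] PWPP-type calibration (provable now, the solver itself is the reduction): a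
polynomial-time MONO-LINE solver is a polynomial-time collision finder for the same circuits read as
a hash [3^n] → [2^⌊n/10⌋] (x ≠ y < 3^n with C(x) = C(y)); since COLLISION at any polynomial
compression is PWPP-complete (Jeřábek 2016, Merkle–Damgård) this yields 'collision-resistant hashing
⇒ X' and 3-PIGEON^(3^n)_(2^(n/10)) ≤ MONO-LINE. [difficulty: provable-now] -/
@[route_item "route-PneNP-MonochromaticLines"]
def CollisionReduces : Prop :=
  let IsLine : ℕ → ℕ → ℕ → ℕ → Prop := fun n x y z => x < 3 ^ n ∧ y < 3 ^ n ∧ z < 3 ^ n ∧ x ≠ y ∧ y ≠ z ∧ x ≠ z ∧ ∀ l : ℕ, l < n → (x / 3 ^ l % 3 + y / 3 ^ l % 3 + z / 3 ^ l % 3) % 3 = 0; let col : (I : (Σ n : ℕ, (Fin (n / 10) → Literature.Computability.Complexity.Circuit (Fin (2 * n))))) → ℕ → (Fin (I.1 / 10) → Bool) := fun I x j => (I.2 j).eval (fun i : Fin (2 * I.1) => decide (x / 3 ^ ((i : ℕ) / 2) % 3 = (i : ℕ) % 2 + 1)); let Valid : (Σ n : ℕ, (Fin (n / 10) → Literature.Computability.Complexity.Circuit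 (Fin (2 * n)))) → Prop := fun I => 200 ≤ I.1 ∧ ∀ j : Fin (I.1 / 10), ∀ g ∈ (I.2 j).gates, g.arity ≤ 2; let dec : List Bool → ℕ × ℕ × ℕ := fun w => (Computability.decodeNat (Literature.Computability.Complexity.boolUnpair w).1, Computability.decodeNat (Literature.Computability.Complexity.boolUnpair (Literature.Computability.Complexity.boolUnpair w).2).1, Computability.decodeNat (Literature.Computability.Complexity.boolUnpair (Literature.Computability.Complexity.boolUnpair w).2).2); let SolStr : (I : (Σ n : ℕ, (Fin (n / 10) → Literature.Computability.Complexity.Circuit (Fin (2 * n))))) → List Bool → Prop := fun I w => IsLine I.1 (dec w).1 (dec w).2.1 (dec w).2.2 ∧ col I (dec w).1 = col I (dec w).2.1 ∧ col I (dec w).2.1 = col I (dec w).2.2; let wire : (m : ℕ) → Fin m ⊕ ℕ → List Bool := fun m w => Sum.elim (fun i : Fin m => false :: Computability.encodeNat (i : ℕ)) (fun j : ℕ => true :: Computability.encodeNat j) w; let code : (m : ℕ) → Literature.Computability.Complexity.Circuit (Fin m) → List Bool := fun m C => Literature.Computability.Complexity.boolPair ((C.gates.map fun g => Literature.Computability.Complexity.boolPair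 (Literature.Computability.MetaComplexity.truthTable g.op) ((List.ofFn fun a : Fin g.arity => wire m (g.args a)).foldr Literature.Computability.Complexity.boolPair [])).foldr Literature.Computability.Complexity.boolPair []) (wire m C.output); let encI : (Σ n : ℕ, (Fin (n / 10) → Literature.Computability.Complexity.Circuit (Fin (2 * n)))) → List Bool := fun I => Literature.Computability.Complexity.boolPair (Computability.unaryEncodeNat I.1) ((List.ofFn fun j : Fin (I.1 / 10) => code (2 * I.1) (I.2 j)).foldr Literature.Computability.Complexity.boolPair []); let CollStr : (I : (Σ n : ℕ, (Fin (n / 10) → Literature.Computability.Complexity.Circuit (Fin (2 * n))))) → List Bool → Prop := fun I w => (dec w).1 < 3 ^ I.1 ∧ (dec w).2.1 < 3 ^ I.1 ∧ (dec w).1 ≠ (dec w).2.1 ∧ col I (dec w).1 = col I (dec w).2.1; (∃ f : (Σ n : ℕ, (Fin (n / 10) → Literature.Computability.Complexity.Circuit (Fin (2 * n)))) → List Bool, (∀ I, Valid I → SolStr I (f I)) ∧ Literature.Computability.Complexity.PolyTimeComputable encI (id : List Bool → List Bool) f) → ∃ g : (Σ n : ℕ, (Fin (n / 10) → Literature.Computability.Complexity.Circuit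 (Fin (2 * n)))) → List Bool, (∀ I, Valid I → CollStr I (g I)) ∧ Literature.Computability.Complexity.PolyTimeComputable encI (id : List Bool → List Bool) g

/-- item stmt-PneNP-11763 · assembly · rank 1 · closed · proved by Summit.PneNP.PneNP.Theorems.monochromaticLines_assembly_proof @ 53a6e6978890 (prover) · by planner
sources: AroraBarakCC2009, Literature.Computability.Complexity.exists_searchFn_of_NP_subset_P, doi:10.1016/0304-3975(91)90200-L
[assembly] MonoLineTotal → MonoLineCheckable → (Nondeterministic.NP ⊆ Classes.P) → MONO-LINE has a
polynomial-time solver (the negation of X's body); with ClassBridge and X this is X → PneNP. -/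
@[route_item "route-PneNP-MonochromaticLines", crux]
def Assembly : Prop :=
  let IsLine : ℕ → ℕ → ℕ → ℕ → Prop := fun n x y z => x < 3 ^ n ∧ y < 3 ^ n ∧ z < 3 ^ n ∧ x ≠ y ∧ y ≠ z ∧ x ≠ z ∧ ∀ l : ℕ, l < n → (x / 3 ^ l % 3 + y / 3 ^ l % 3 + z / 3 ^ l % 3) % 3 = 0; let col : (I : (Σ n : ℕ, (Fin (n / 10) → Literature.Computability.Complexity.Circuit (Fin (2 * n))))) → ℕ → (Fin (I.1 / 10) → Bool) := fun I x j => (I.2 j).eval (fun i : Fin (2 * I.1) => decide (x / 3 ^ ((i : ℕ) / 2) % 3 = (i : ℕ) % 2 + 1)); let Valid : (Σ n : ℕ, (Fin (n / 10) → Literature.Computability.Complexity.Circuit (Fin (2 * n)))) → Prop := fun I => 200 ≤ I.1 ∧ ∀ j : Fin (I.1 / 10), ∀ g ∈ (I.2 j).gates, g.arity ≤ 2; let dec : List Bool → ℕ × ℕ × ℕ := fun w => (Computability.decodeNat (Literature.Computability.Complexity.boolUnpair w).1, Computability.decodeNat (Literature.Computability.Complexity.boolUnpair (Literature.Computability.Complexity.boolUnpair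 w).2).1, Computability.decodeNat (Literature.Computability.Complexity.boolUnpair (Literature.Computability.Complexity.boolUnpair w).2).2); let SolStr : (I : (Σ n : ℕ, (Fin (n / 10) → Literature.Computability.Complexity.Circuit (Fin (2 * n))))) → List Bool → Prop := fun I w => IsLine I.1 (dec w).1 (dec w).2.1 (dec w).2.2 ∧ col I (dec w).1 = col I (dec w).2.1 ∧ col I (dec w).2.1 = col I (dec w).2.2; let wire : (m : ℕ) → Fin m ⊕ ℕ → List Bool := fun m w => Sum.elim (fun i : Fin m => false :: Computability.encodeNat (i : ℕ)) (fun j : ℕ => true :: Computability.encodeNat j) w; let code : (m : ℕ) → Literature.Computability.Complexity.Circuit (Fin m) → List Bool := fun m C => Literature.Computability.Complexity.boolPair ((C.gates.map fun g => Literature.Computability.Complexity.boolPair (Literature.Computability.MetaComplexity.truthTable g.op) ((List.ofFn fun a : Fin g.arity => wire m (g.args a)).foldr Literature.Computability.Complexity.boolPair [])).foldr Literature.Computability.Complexity.boolPair []) (wire m C.output); let encI : (Σ n : ℕ, (Fin (n / 10) → Literature.Computability.Complexity.Circuit (Fin (2 * n)))) → List Bool := fun I => Literature.Computability.Complexity.boolPair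 (Computability.unaryEncodeNat I.1) ((List.ofFn fun j : Fin (I.1 / 10) => code (2 * I.1) (I.2 j)).foldr Literature.Computability.Complexity.boolPair []); MonoLineTotal → MonoLineCheckable → Literature.Computability.Complexity.Nondeterministic.NP ⊆ Literature.Computability.Complexity.Classes.P → ∃ f : (Σ n : ℕ, (Fin (n / 10) → Literature.Computability.Complexity.Circuit (Fin (2 * n)))) → List Bool, (∀ I, Valid I → SolStr I (f I)) ∧ Literature.Computability.Complexity.PolyTimeComputable encI (id : List Bool → List Bool) f

/-! D-0027 §2.1 — DECIDING THEOREM (planner-authored via `route open/edit --closes-file`; by planner-plancard-PneNP-PneNP-cap-set-search-d-97e4efc7-0 2026-08-15T18:42:42Z):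
its hypotheses are this route's items and its conclusion the sub-problem Statement (glue_lint), and it elaborates with this file. -/

@[closes "route-PneNP-MonochromaticLines"] theorem closes (hX : MonoLineHard) (hT : MonoLineTotal) (hC : MonoLineCheckable) (hB : ClassBridge) (hA : Assembly) : _root_.PneNP :=
  Classical.byContradiction fun hne => hX (hA hT hC (hB fun L hL => Classical.byContradiction fun hP => hne ⟨L, hL, hP⟩))

end Summit.PneNP.PneNP.Theses.MonochromaticLines
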